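import Literature.Computability.AlgebraicComplexity.UnitTensorMomentPolytopeProofs
import Literature.Computability.AlgebraicComplexity.QuantumFunctionalsDegenerationProofs
import HarnessLib

/-!
# Occurrence of isotypic types is monotone under degeneration; `Δ(s) ⊆ Δ(⟨4⟩)` for `s ⊴ ⟨4⟩`

Topic `Computability/AlgebraicComplexity`; proofs file (theorems only, no definitions, no named
facts) of the named fact `vandenBergEtAl2025_unitTensor_four_polytope_maximal`
(`UnitTensorMomentPolytope.lean`: "`Δ(⟨4⟩) = Kron(4,4,4)`" in semigroup form — every partition triple
occurring in a power of a tensor `s` of format `≤ 4 × 4 × 4` has a multiple occurring in a power of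
the unit tensor `⟨4⟩`). The sibling `UnitTensorMomentPolytopeProofs.lean` proves that OCCURRENCE
(non-vanishing of the triple isotypic character sum `isotypicSum₁ λ⁰ ∘ isotypicSum₂ λ¹ ∘ isotypicSum₃ λ²`
on `kroneckerPow s n`) is monotone under RESTRICTION and deduces the fact, unscaled (`k = 1`), for
every restriction of `⟨4⟩` (tensor rank `≤ 4`). This file does the same for DEGENERATIONS
(orbit closures, `TensorDegeneratesTo` of `QuantumFunctionals.lean`), which is how the sources state
the monotonicity:

* [vandenBergChristandlLysikovNieuwboerWalterZuiddam2025, Prop. 2.7]: "`T ⊵ T'` implies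
  `Δ(T) ⊇ Δ(T')`" (degeneration = orbit closure, ibid. §2.2);
* [BurgisserIkenmeyer2011, §3.1, after (3.1)]: for `w' ∈ cl(G·w)` the restriction of regular
  functions `𝒪(cl(Gw)) → 𝒪(cl(Gw'))` is a `G`-equivariant surjection, so the semigroup of
  representations can only shrink: `S(w') ⊆ S(w)`.

## What is proved (sorry-free)

* `isotypicSum₁₂₃_kroneckerPow_ne_zero_of_degeneratesTo` — **occurrence is monotone under
  degeneration**: if `s ⊵ t` and `λ` occurs in `t^{⊗n}` then `λ` occurs in `s^{⊗n}`. Printed proof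
  (CVZ, proof of Lemma 3.6 / Lemma 3.20): `u ↦ P_λ u^{⊗n}` is continuous and `G`-equivariant, so its
  zero set is closed and `G`-stable; if it contained `s` it would contain the orbit closure, hence
  `t`. In the tree this is `UpperAdmissible.of_degeneratesTo` (`QuantumFunctionalsUpperMonotone.lean`)
  at the all-ones weight `θ ≡ 1`, for which the operator `upperProjection θ λ` of CVZ Def. 3.3 is the
  full triple isotypic sum (`upperAdmissible_one_iff`).
* `TensorDegeneratesTo.trans` — `⊵` is transitive (orbit closures are `G`-stable and closed;
  CVZ Rem. 1.2), and `isotypicSum₁₂₃_kroneckerPow_ne_zero_of_degeneratesTo_of_restrictsTo` —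
  occurrence transfers along a degeneration followed by a restriction to any format.
* `vandenBergEtAl2025_unitTensor_four_polytope_maximal_of_degeneratesTo` — the conclusion of the
  named fact **with `k = 1`** for every degeneration `s` of `⟨4⟩` in format `4 × 4 × 4` (i.e. every
  `s ∈ cl(GL₄³·⟨4⟩)`, the tensors of border rank `≤ 4`): there already the unscaled semigroup
  inclusion `S(s) ⊆ S(⟨4⟩)` holds;
* `vandenBergEtAl2025_unitTensor_four_polytope_maximal_of_degeneratesTo_of_restrictsTo` — the same
  for every restriction (to any format) of such a degeneration.

## What is NOT proved

The named fact itself (all `s` of format `≤ 4×4×4`, border rank up to `7`), i.e.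
`Kron(4,4,4) ⊆ Δ(⟨4⟩)`: its only known proof is the Vergne–Walter description of `Kron(4,4,4)` plus
certified tensor-scaling inclusions [vandenBergEtAl2025ComputingMomentPolytopes, §6.2, §6.5], neither
of which is in the tree (see `UnitTensorMomentPolytopeReduction.lean` and the unit's `NOTES.md`,
`## Census`). For `s` outside the orbit closure of `⟨4⟩` a scaling `k ≥ 2` can be necessary
(BI 2011, Lemma 6.1).

## References

* [vandenBergChristandlLysikovNieuwboerWalterZuiddam2025] M. van den Berg, M. Christandl, V. Lysikov,
  H. Nieuwboer, M. Walter, J. Zuiddam, *The moment polytope of matrix multiplication is not maximal*,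
  arXiv:2503.22633, §1 (after Cor. 1.5), §2.2 Prop. 2.7.
* [vandenBergEtAl2025ComputingMomentPolytopes] same authors, arXiv:2510.08336, §6.2, §6.5.
* [BurgisserIkenmeyer2011] P. Bürgisser, C. Ikenmeyer, *Geometric complexity theory and tensor rank*,
  STOC 2011 = arXiv:1011.1350, §3.1, Lemma 6.1.
* [ChristandlVranaZuiddam2023] M. Christandl, P. Vrana, J. Zuiddam, J. Amer. Math. Soc. 36 (2023),
  Rem. 1.2, Lemma 3.6 and Lemma 3.20 (proofs).
-/

noncomputable section

open scoped BigOperators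

namespace Literature.Computability.AlgebraicComplexity

universe u

/-! ## Degeneration is a preorder -/

section Preorder

variable {ι κ μ : Type*} [Fintype ι] [Fintype κ] [Fintype μ] [DecidableEq ι] [DecidableEq κ]
  [DecidableEq μ]

/-- **`⊵` is transitive**: if `s ⊵ t` and `t ⊵ u` then `s ⊵ u` — the orbit closure `cl(G·s)` is
closed and `G`-stable (`TensorDegeneratesTo.actTensor_right`), so it contains `cl(G·t)` as soon as it
contains `t` (CVZ Rem. 1.2: degeneration is a preorder). [cite: ChristandlVranaZuiddam2023, Rem. 1.2] -/
theorem TensorDegeneratesTo.trans {s t u : ι → κ → μ → ℂ} (hst : TensorDegeneratesTo s t)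
    (htu : TensorDegeneratesTo t u) : TensorDegeneratesTo s u := by
  unfold TensorDegeneratesTo at htu ⊢
  refine (closure_minimal ?_ isClosed_closure) htu
  rintro _ ⟨g, rfl⟩
  exact hst.actTensor_right g

end Preorder

/-! ## Occurrence of isotypic types is monotone under degeneration -/

section Degeneration

variable {ι κ μ : Type u} [Fintype ι] [Fintype κ] [Fintype μ] [DecidableEq ι] [DecidableEq κ]
  [DecidableEq μ] {n : ℕ}

omit [Fintype ι] [Fintype κ] [Fintype μ] [DecidableEq ι] [DecidableEq κ] [DecidableEq μ] in
/-- At the all-ones weight `θ ≡ 1` (every factor in the support) the operator of CVZ Def. 3.3 is the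
full triple isotypic character sum, so admissibility is occurrence of the triple `λ` in `t^{⊗n}`.
[cite: ChristandlVranaZuiddam2023, Def. 3.3] -/
theorem upperAdmissible_one_iff {t : ι → κ → μ → ℂ} {lam : Fin 3 → Nat.Partition n} :
    UpperAdmissible (fun _ : Fin 3 => (1 : ℝ)) t n lam ↔
      isotypicSum₁ (lam 0) (isotypicSum₂ (lam 1) (isotypicSum₃ (lam 2) (kroneckerPow t n))) ≠ 0 := by
  simp [UpperAdmissible, upperProjection]

/-- **Occurrence is monotone under degeneration** (`S(t) ⊆ S(s)` for `s ⊵ t`): if `t` lies in the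
closure of the `GL × GL × GL`-orbit of `s` and the partition triple `λ ⊢ n` occurs in `t^{⊗n}` (the
triple isotypic character sum does not kill it), then `λ` occurs in `s^{⊗n}`. Proof as printed for
CVZ Lemma 3.6/3.20: the zero set of the continuous equivariant map `u ↦ P_λ u^{⊗n}` is closed and
`G`-stable. [cite: vandenBergChristandlLysikovNieuwboerWalterZuiddam2025, Prop. 2.7]
[cite: BurgisserIkenmeyer2011, §3.1] -/
theorem isotypicSum₁₂₃_kroneckerPow_ne_zero_of_degeneratesTo {s t : ι → κ → μ → ℂ}
    (hst : TensorDegeneratesTo s t) {lam : Fin 3 → Nat.Partition n}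
    (h : isotypicSum₁ (lam 0) (isotypicSum₂ (lam 1) (isotypicSum₃ (lam 2) (kroneckerPow t n))) ≠ 0) :
    isotypicSum₁ (lam 0) (isotypicSum₂ (lam 1) (isotypicSum₃ (lam 2) (kroneckerPow s n))) ≠ 0 :=
  upperAdmissible_one_iff.1 ((upperAdmissible_one_iff.2 h).of_degeneratesTo hst)

/-- **Occurrence is monotone under degeneration followed by restriction**: if `s ⊵ t`, `t ≥ r`
(`TensorRestrictsTo t r`, `r` of any format) and `λ` occurs in `r^{⊗n}`, then `λ` occurs in `s^{⊗n}`.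
[cite: vandenBergChristandlLysikovNieuwboerWalterZuiddam2025, Prop. 2.7] -/
theorem isotypicSum₁₂₃_kroneckerPow_ne_zero_of_degeneratesTo_of_restrictsTo
    {ι' κ' μ' : Type u} [Fintype ι'] [Fintype κ'] [Fintype μ']
    {s t : ι → κ → μ → ℂ} {r : ι' → κ' → μ' → ℂ} (hst : TensorDegeneratesTo s t)
    (htr : TensorRestrictsTo t r) {lam : Fin 3 → Nat.Partition n}
    (h : isotypicSum₁ (lam 0) (isotypicSum₂ (lam 1) (isotypicSum₃ (lam 2) (kroneckerPow r n))) ≠ 0) :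
    isotypicSum₁ (lam 0) (isotypicSum₂ (lam 1) (isotypicSum₃ (lam 2) (kroneckerPow s n))) ≠ 0 :=
  isotypicSum₁₂₃_kroneckerPow_ne_zero_of_degeneratesTo hst
    (isotypicSum₁₂₃_kroneckerPow_ne_zero_of_restrictsTo htr h)

end Degeneration

/-! ## The named fact for degenerations of `⟨4⟩` (the unscaled case `k = 1`) -/

/-- **`Δ(s) ⊆ Δ(⟨4⟩)` — indeed `S(s) ⊆ S(⟨4⟩)` — for degenerations `s ⊴ ⟨4⟩`**, in the semigroup form
of `vandenBergEtAl2025_unitTensor_four_polytope_maximal` with `k = 1`: if `s ∈ ℂ⁴ ⊗ ℂ⁴ ⊗ ℂ⁴` lies in the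
orbit closure of the unit tensor `⟨4⟩` (border rank `≤ 4`), then every partition triple `λ ⊢ n`
occurring in `s^{⊗n}` occurs in `⟨4⟩^{⊗n}` itself, so the conclusion of the named fact holds with
`k = 1`, `μ = λ`. (The named fact — all `s` of format `≤ 4×4×4`, border rank up to `7`, where `k ≥ 2`
can be necessary — is `Kron(4,4,4) ⊆ Δ(⟨4⟩)` and is NOT proved in the tree; module docstring.)
[cite: vandenBergChristandlLysikovNieuwboerWalterZuiddam2025, Prop. 2.7 and §1 after Cor. 1.5]
[cite: BurgisserIkenmeyer2011, §3.1] -/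
theorem vandenBergEtAl2025_unitTensor_four_polytope_maximal_of_degeneratesTo
    {s : Fin 4 → Fin 4 → Fin 4 → ℂ} (hs : TensorDegeneratesTo (unitTensor ℂ 4) s)
    {n : ℕ} {lam : Fin 3 → Nat.Partition n}
    (h : isotypicSum₁ (lam 0) (isotypicSum₂ (lam 1) (isotypicSum₃ (lam 2) (kroneckerPow s n))) ≠ 0) :
    ∃ (k : ℕ) (mu : Fin 3 → Nat.Partition (k * n)), 0 < k ∧
      (∀ j, (mu j).parts = (lam j).parts.map (fun p => k * p)) ∧
        isotypicSum₁ (mu 0) (isotypicSum₂ (mu 1) (isotypicSum₃ (mu 2)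
          (kroneckerPow (unitTensor ℂ 4) (k * n)))) ≠ 0 :=
  -- `⟨4⟩ ≥ ⟨4⟩` turns the degeneration statement into the restriction-form lemma of the sibling file
  vandenBergEtAl2025_unitTensor_four_polytope_maximal_of_restrictsTo (TensorRestrictsTo.refl _)
    (isotypicSum₁₂₃_kroneckerPow_ne_zero_of_degeneratesTo hs h)

/-- **The named fact for restrictions of degenerations of `⟨4⟩`** (`k = 1`, any target format): if
`⟨4⟩ ⊵ t` in `ℂ⁴ ⊗ ℂ⁴ ⊗ ℂ⁴` and `t ≥ s` (`s` of any finite format), then every partition triple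
occurring in a power of `s` occurs in the same power of `⟨4⟩`.
[cite: vandenBergChristandlLysikovNieuwboerWalterZuiddam2025, Prop. 2.7 and §1 after Cor. 1.5] -/
theorem vandenBergEtAl2025_unitTensor_four_polytope_maximal_of_degeneratesTo_of_restrictsTo
    {ι κ μ : Type} [Fintype ι] [Fintype κ] [Fintype μ] {t : Fin 4 → Fin 4 → Fin 4 → ℂ}
    (ht : TensorDegeneratesTo (unitTensor ℂ 4) t) {s : ι → κ → μ → ℂ} (hts : TensorRestrictsTo t s)
    {n : ℕ} {lam : Fin 3 → Nat.Partition n}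
    (h : isotypicSum₁ (lam 0) (isotypicSum₂ (lam 1) (isotypicSum₃ (lam 2) (kroneckerPow s n))) ≠ 0) :
    ∃ (k : ℕ) (mu : Fin 3 → Nat.Partition (k * n)), 0 < k ∧
      (∀ j, (mu j).parts = (lam j).parts.map (fun p => k * p)) ∧
        isotypicSum₁ (mu 0) (isotypicSum₂ (mu 1) (isotypicSum₃ (mu 2)
          (kroneckerPow (unitTensor ℂ 4) (k * n)))) ≠ 0 :=
  vandenBergEtAl2025_unitTensor_four_polytope_maximal_of_degeneratesTo ht
    (isotypicSum₁₂₃_kroneckerPow_ne_zero_of_restrictsTo hts h)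

end Literature.Computability.AlgebraicComplexity
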